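import Summits.Ventures.HSemireg.Pad4TowerPsiSubA1
import Summits.Ventures.HSemireg.Pad4FCCore

/-!
# Venture HSemireg — PAD-4: the FC-CORE SEAM — the modelling sentence of the kernel LEMMA FC-CORE (`Pad4FCCore`, gs-eng-2 g51, key 840)
# PROVED in the class frame of record, and `Pad4FCCore.MixedRowsVanish` DERIVED FROM (A1): for every weighted 𝔅(μ₄) configuration
# whose fully charged classes lie in the two-phase window `𝒜_{1,i}`, the class screen forces FC-CORE's 28 rows, its μ is the
# `ēēēē`-coefficient, and «μ ≠ 0 ⇒ fully charged classes in all eight even or all eight odd phase patterns» holds in the kernel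

HONEST FRAMING. Lean index of the computation cell `pub-hsemireg` (S4-PUSH, H2 door PAD-4), typed by the Ventures-side typer
`hodge-lit-semireg-typer-2` (g4; line of record stmt-HodgeConjecture-18881 `Cruxes/BlochSeedDiscOne/Lines/birth.lean` 814a6a70c14e831a,
stub `stub_rung_pad4_seedAt`, screen (H1); card v4.10 row W13 (A) LEMMA FC-CORE). Sixth file of the KERNEL LEMMA Ψ ⊂ (A1) set. The kernel
LEMMA FC-CORE `Pad4FCCore` (gs-eng-2 g51 p588880; hostile reads ×2 s4-ref g85 ∕ s4-ref-2 g29) proves, for pattern weights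
`x : Fin 16 → ℚ` satisfying its hypothesis structure `MixedRowsVanish x` (the 28 real forms `Re ∕ Im Σ_κ x_κ i^{⟨κ,s⟩} = 0`, `s` mixed),
that `8x_κ = Re(μ i^{−|κ|})` and the corollaries `eight_patterns_of_mu_ne`, `eq_zero_of_lone_κ`; its header names «the one pencil step
NOT re-proved here»: the MODELLING SENTENCE «the coefficient of a pure-e∕ē word `w_s` vanishes on every class that is not fully charged
and equals `C_Z · i^{⟨κ(Z), s⟩}` on a fully charged class `Z` whose phases are `ζ_f = i^{k_f}`, `k_f ∈ {0,1}` … Aggregating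
`x_κ := Σ_{Z FC, κ(Z) = κ} ε_Z m_Z C_Z`, the (A1) condition … contains the 14 equations `Σ_κ x_κ i^{⟨κ,s⟩} = 0` (s mixed), and
`μ := coeff(eeee) = Σ_κ x_κ i^{|κ|}`». THIS FILE PROVES THAT SENTENCE in the frame of `Pad4TowerClassScreen` ∕ `Pad4TowerPsiSubA1`
(`CWord`, `ClassScreen`, `bphi`, `MCell.ch`, `MConfig.wch`) and feeds `Pad4FCCore`'s theorems.

SPEC OF RECORD. This is gs-eng-2 g51's RESULT 11 SPEC «FC-CORE MODELLING IN THE FRAME» (cell INBOX l.31868, 2026-08-28T00:54Z: (M1)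
pureE_coeff, (M2) fc_letter, (M3) aggregate by `Finset.sum_fiberwise`, (LINK) real∕imaginary parts = the fields of the kernel structure)
carried out for the TWO-PHASE WINDOW and the `ℚ`-form `Pad4FCCore` (840): (M1)+(M2) = `MCell.ch_sWord` ∕ `MCell.ch_sWord_eq_zero`, (M3) =
`sum_ch_sWord` ∕ `MConfig.wch_sWord`, (LINK) = `MConfig.mixedRowsVanish_of_classScreen` ∕ `MConfig.mu_fcCore`. The μ₄ PARITY link to
`Pad4FCCoreParity` (843; 256 patterns) and gs-eng-2 g51's ring forms `Pad4FCCoreRing(Parity)` (RESULT 12, l.31894) are the same construction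
with `(ℤ∕4)⁴` patterns — NOT in this file.

CONVENTION SEAM (s4-ref g85 (B) P1; `Pad4TowerPsiSubA1` header (a)). `Pad4FCCore`'s `e`-slot carries pad4lib's `β = c·ζ`; this frame's
`e`-slot carries `β = c·ζ̄` (FILE A ∕ `Pad4TowerLlite` ∕ PAD4-THEOREM-L (6.5)), so pad4lib's `e` is this frame's `ē`. Accordingly the word
of a sign vector `s` is typed here as `sWord s` := letter `ē` where `s_f = +1`, letter `e` where `s_f = −1`; with this dictionary the
coefficient tables agree ENTRY BY ENTRY with `Pad4FCCore`'s (checked: `mixedRowsVanish_of_classScreen` instantiates its structure field by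
field), and FC-CORE's `μ = coeff(eeee)` is this frame's `ēēēē`-coefficient `wch ebarWord` (`mu_fcCore`) — the complex conjugate of FILE A's
μ-word orientation (`Pad4TowerPsiSubA1.Design.ch_eWord`); `wch_ebarWord_eq_star` proves `wch(ēēēē) = conj wch(eeee)`, so
non-vanishing is the same condition (`eight_patterns_of_classScreen'` takes the `eeee` form).

CONTENT (all PROVED; no `sorry`; axioms standard).
* §1 `bitOf` (4-bit indices, factor `0` = most significant = `Pad4FCCore`'s factor 1), `sWord`, `expKS κ s = ⟨κ,s⟩ mod 4` (`s_f = −1 ↦ +3k_f`),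
  `unitI = i`; `sWord_spec` (`decide`: sign words are e-mixed, `sWord 0 = ēēēē`, `sWord 15 = eeee`, the 14 others are neither);
  `sum16`, `dot16` (sixteen-term expansions).
* §2 `WinPt` ∕ `WinCell` (charged letters of `𝒜_{1,i}`: `β = c` or `β = c·ī`, `c ≥ 1`), `FCc` (fully charged), `kbit`, `chargeOf`, `MCell.pat`
  (`κ(Z) = 8k₀+4k₁+2k₂+k₃`), `bitOf_pat`, `MCell.cprod` (`C_Z = Π c_f`), `bphi_win` (ē-entry `c·i^k`, e-entry `c·i^{3k}`), `unitI_pow_mod`;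
  **`MCell.ch_sWord`: on a fully charged window cell `ch(Z)(w_s) = C_Z · i^{⟨κ(Z),s⟩}`** and **`MCell.ch_sWord_eq_zero`: a class with an
  uncharged factor contributes `0`** — THE MODELLING SENTENCE, per class.
* §3 `MConfig.xPat` (`x_κ = Σ_{N FC, κ(N)=κ} m C − Σ_{P FC, κ(P)=κ} m C`; orientation `N − P` as `wch`), `sum_ch_sWord` (fiberwise aggregation),
  **`MConfig.wch_sWord`: `wch(w_s) = Σ_κ x_κ · i^{⟨κ,s⟩}`** (hypothesis: the FULLY CHARGED classes of the support lie in the window; other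
  classes unconstrained), `reHom` ∕ `imHom` (real ∕ imaginary part as additive maps — definitions, not instances),
  **`MConfig.rows_of_classScreen`**: (A1) ⇒ both parts of every mixed row vanish.
* §4 **`MConfig.mixedRowsVanish_of_classScreen : … → Pad4FCCore.MixedRowsVanish (fun κ => (x_κ : ℚ))`** (the 28 fields, each from the
  corresponding row through a `decide`d coefficient vector — the tables agree), **`MConfig.mu_fcCore`** (`Pad4FCCore.muRe ∕ muIm x` = `Re ∕ Im`
  of `wch(ēēēē)`), `MConfig.wch_ebarWord_eq_star` (`= star wch(eeee)`, s4-ref g85 (F) P1),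
  **`MConfig.eight_patterns_of_classScreen`** (and `'` with the `eeee` hypothesis) (=
  `Pad4FCCore.eight_patterns_of_mu_ne` for weighted configurations: window,
  (A1), `wch(ēēēē) ≠ 0` ⇒ all eight even-weight or all eight odd-weight `x_κ ≠ 0`), `MConfig.exists_of_xPat_ne` (`x_κ ≠ 0` ⇒ a fully
  charged class of pattern κ is PRESENT) — so an (A1)-feasible two-phase support with μ ≠ 0 holds fully charged classes of ≥ 8 patterns.

WHAT IS NOT HERE ∕ NOT IN LEAN. The (H1)-LP itself; FC-CORE's PARITY FORM for all of μ₄ (843; same method with `(−1)^{#(k ≥ 2)}`); face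
balance; any SAT verdict. The identification of the frame with `H^{ev}(S⁴)` ∕ of the screen with PAD4-FIRSTORDER §0's (A1)-target stays the
cell's pencil modelling sentence. No variety, sheaf, σ, seed or abelian variety; NOTHING HERE SAYS THAT HC ∕ HC_CM ∕ HC_AV ∕ W₆ ∕ HC_Kum4Type
HOLDS OR FAILS. No `instance`, no notation, no named fact, 0 `sorry`.

SOURCES (sha16): `Pad4FCCore.lean` (tree, gs-eng-2 g51 v1 77cf033c04df8791, p588880; header modelling sentence, index conventions);
LEMMA-FCCORE-gs2g51.md v1.3 eed5177b5e337200; verdicts s4-ref-2 g29 4a372eaa9b78fac6, s4-ref g85 l.31754; RESULT 11 l.31868; pad4lib.py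
298d123426f6a4be (`phi`); `Pad4TowerClassScreen.lean` 1ffb82cfe6f0a1dc (p591160), `Pad4TowerPsiSubA1.lean` 8a8ffcebf99475df,
`Pad4TowerCrossPhase.lean` 8f09792281b0723a (`MCell`, letters `lpt c k`, `β = c·conj(i^k)`).
-/

namespace Summit.Ventures.HSemireg.Pad4Tower

open Finset

/-! ## §1 Patterns, sign vectors, their words in THIS frame, and the tables `Re ∕ Im i^{⟨κ,s⟩}` -/

/-- bit `f` of a 4-bit index, factor `0` = most significant bit (`Pad4FCCore`: pattern index `8k₁+4k₂+2k₃+k₄`, sign vectors likewise). -/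
def bitOf (n : Fin 16) (f : Fin 4) : ℕ := (n.val / 2 ^ (3 - f.val)) % 2

/-- the WORD of the sign vector `s` in THIS frame: letter `ē` (`4`) on the factors with `s_f = +1` (bit `0`), letter `e` (`3`) where
`s_f = −1` (bit `1`). CONVENTION SEAM: `Pad4FCCore`'s `e`-slot is pad4lib's `β = c·ζ`, which is THIS frame's `ē`-slot (`β̄`; here
`β = c·ζ̄`, FILE A ∕ `Pad4TowerLlite` ∕ PAD4-THEOREM-L (6.5)) — `Pad4TowerPsiSubA1` header (a), s4-ref g85 (B) P1. -/
def sWord (s : Fin 16) : CWord := fun f => if bitOf s f = 0 then 4 else 3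

/-- the exponent `⟨κ, s⟩ = Σ_f k_f s_f (mod 4)` as a natural number (`s_f = +1 ↦ k_f`, `s_f = −1 ↦ 3k_f`). -/
def expKS (κ s : Fin 16) : ℕ := (∑ f : Fin 4, bitOf κ f * (if bitOf s f = 0 then 1 else 3)) % 4

/-- the Gaussian unit `i` (local name). -/
def unitI : GaussianInt := ⟨0, 1⟩

/-- the sign words are e-mixed: never e-free; `sWord 0 = ēēēē`, `sWord 15 = eeee`, and for `s ∉ {0, 15}` neither. [kernel, `decide`] -/
theorem sWord_spec :
    (∀ s : Fin 16, ¬ EFree (sWord s)) ∧ sWord 0 = ebarWord ∧ sWord 15 = eWord ∧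
      ∀ s : Fin 16, s ≠ 0 → s ≠ 15 → sWord s ≠ eWord ∧ sWord s ≠ ebarWord := by
  refine ⟨by decide, by decide, by decide, by decide⟩

/-- a sum over the sixteen patterns, written out. -/
theorem sum16 {M : Type*} [AddCommMonoid M] (f : Fin 16 → M) :
    ∑ κ : Fin 16, f κ = f 0 + f 1 + f 2 + f 3 + f 4 + f 5 + f 6 + f 7 + f 8 + f 9 + f 10 + f 11 + f 12 + f 13 + f 14 +
      f 15 := by
  simp only [Fin.sum_univ_succ, Fin.sum_univ_zero, add_zero]
  simp only [add_assoc]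
  rfl

/-- a sixteen-term dot product against a coefficient function KNOWN to equal a vector literal, written out. -/
theorem dot16 (x c v : Fin 16 → ℤ) (hv : c = v) (h : ∑ κ : Fin 16, x κ * c κ = 0) :
    x 0 * v 0 + x 1 * v 1 + x 2 * v 2 + x 3 * v 3 + x 4 * v 4 + x 5 * v 5 + x 6 * v 6 + x 7 * v 7 + x 8 * v 8 +
      x 9 * v 9 + x 10 * v 10 + x 11 * v 11 + x 12 * v 12 + x 13 * v 13 + x 14 * v 14 + x 15 * v 15 = 0 := by
  subst hv
  rwa [sum16] at h

/-- the same dot product, cast to `ℚ` (the coefficient field of `Pad4FCCore`). -/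
theorem dot16q (x c v : Fin 16 → ℤ) (hv : c = v) (h : ∑ κ : Fin 16, x κ * c κ = 0) :
    (x 0 : ℚ) * v 0 + (x 1 : ℚ) * v 1 + (x 2 : ℚ) * v 2 + (x 3 : ℚ) * v 3 + (x 4 : ℚ) * v 4 + (x 5 : ℚ) * v 5 +
      (x 6 : ℚ) * v 6 + (x 7 : ℚ) * v 7 + (x 8 : ℚ) * v 8 + (x 9 : ℚ) * v 9 + (x 10 : ℚ) * v 10 + (x 11 : ℚ) * v 11 +
      (x 12 : ℚ) * v 12 + (x 13 : ℚ) * v 13 + (x 14 : ℚ) * v 14 + (x 15 : ℚ) * v 15 = 0 := by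
  have hq := congrArg (Int.cast : ℤ → ℚ) (dot16 x c v hv h)
  push_cast at hq
  linear_combination hq

/-! ## §2 Window cells: pattern, charge product, and THE MODELLING SENTENCE per class -/

/-- a factor point is a CHARGED LETTER OF THE TWO-PHASE WINDOW `𝒜_{1,i}`: `β = c` (phase `1`, `k = 0`) or `β = −c·i = c·ī`
(phase `i`, `k = 1`; this frame `β = c ζ̄`), `c ≥ 1`. Decidable. -/
abbrev WinPt (x : BPoint) : Prop := (0 < x.2.1 ∧ x.2.2 = 0) ∨ (x.2.1 = 0 ∧ x.2.2 < 0)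

/-- every factor of the cell is a charged window letter (a fully charged `𝒜_{1,i}` class). -/
abbrev WinCell (Z : MCell) : Prop := ∀ f, WinPt (Z f)

/-- FULLY CHARGED: every `β_f ≠ 0`. Decidable. -/
abbrev FCc (Z : MCell) : Prop := ∀ f, (Z f).2 ≠ (0, 0)

/-- the phase bit `k_f` of a window letter: `0` for phase `1` (`Im β = 0`), `1` for phase `i`. -/
def kbit (x : BPoint) : ℕ := if x.2.2 = 0 then 0 else 1

/-- the charge `c_f` of a window letter (`Re β − Im β` = `c` in both cases). -/
def chargeOf (x : BPoint) : ℤ := x.2.1 - x.2.2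

/-- the phase bit is `0` or `1`. -/
theorem kbit_le_one (x : BPoint) : kbit x ≤ 1 := by
  unfold kbit; split_ifs <;> omega

/-- the PATTERN INDEX `κ(Z) = 8k₀ + 4k₁ + 2k₂ + k₃` of a cell (`Pad4FCCore`'s `8k₁+4k₂+2k₃+k₄`, factors numbered from `0` here). -/
def MCell.pat (Z : MCell) : Fin 16 :=
  ⟨8 * kbit (Z 0) + 4 * kbit (Z 1) + 2 * kbit (Z 2) + kbit (Z 3), by
    have h0 := kbit_le_one (Z 0); have h1 := kbit_le_one (Z 1); have h2 := kbit_le_one (Z 2); have h3 := kbit_le_one (Z 3)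
    omega⟩

/-- the bits of the pattern index are the phase bits. -/
theorem bitOf_pat (Z : MCell) (f : Fin 4) : bitOf Z.pat f = kbit (Z f) := by
  have h0 := kbit_le_one (Z 0); have h1 := kbit_le_one (Z 1); have h2 := kbit_le_one (Z 2); have h3 := kbit_le_one (Z 3)
  fin_cases f <;> simp [bitOf, MCell.pat] <;> omega

/-- the CHARGE PRODUCT `C_Z = Π_f c_f`. -/
def MCell.cprod (Z : MCell) : ℤ := chargeOf (Z 0) * chargeOf (Z 1) * chargeOf (Z 2) * chargeOf (Z 3)

/-- on a window letter: the `ē`-entry is `c · i^{k}`, the `e`-entry is `c · i^{3k}` (`= c · i^{−k}`). -/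
theorem bphi_win (x : BPoint) (hx : WinPt x) :
    bphi x 4 = (chargeOf x : GaussianInt) * unitI ^ kbit x ∧ bphi x 3 = (chargeOf x : GaussianInt) * unitI ^ (3 * kbit x) := by
  obtain ⟨α, b1, b2⟩ := x
  rcases hx with ⟨hpos, hb2⟩ | ⟨hb1, hneg⟩
  · simp only at hb2
    subst hb2
    simp [bphi, phiVec, chargeOf, kbit, unitI, Zsqrtd.ext_iff]
  · simp only at hb1
    subst hb1
    have hne : b2 ≠ 0 := ne_of_lt hneg
    simp [bphi, phiVec, chargeOf, kbit, unitI, Zsqrtd.ext_iff, hne, pow_succ]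

/-- `i⁴ = 1`, so powers of `i` depend on the exponent mod 4. -/
theorem unitI_pow_mod (n : ℕ) : unitI ^ n = unitI ^ (n % 4) := by
  conv_lhs => rw [← Nat.mod_add_div n 4, pow_add, pow_mul, show unitI ^ 4 = 1 by decide, one_pow, mul_one]

/-- **THE MODELLING SENTENCE OF LEMMA FC-CORE, per class** (`Pad4FCCore` header «the one pencil step NOT re-proved here»): on a fully
charged two-phase cell, the coefficient of the word of the sign vector `s` is `C_Z · i^{⟨κ(Z), s⟩}`. -/
theorem MCell.ch_sWord (Z : MCell) (hZ : WinCell Z) (s : Fin 16) :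
    Z.ch (sWord s) = (Z.cprod : GaussianInt) * unitI ^ expKS Z.pat s := by
  have key : ∀ f, bphi (Z f) (sWord s f) =
      (chargeOf (Z f) : GaussianInt) * unitI ^ (kbit (Z f) * if bitOf s f = 0 then 1 else 3) := by
    intro f
    obtain ⟨h4, h3⟩ := bphi_win (Z f) (hZ f)
    by_cases hb : bitOf s f = 0
    · simp [sWord, hb, h4]
    · simp [sWord, hb, h3, mul_comm]
  rw [MCell.ch, chTensor, key 0, key 1, key 2, key 3, expKS, Fin.sum_univ_four, bitOf_pat, bitOf_pat, bitOf_pat, bitOf_pat,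
    ← unitI_pow_mod, MCell.cprod]
  push_cast
  ring

/-- a class with an uncharged factor contributes NOTHING to a pure `e∕ē` word. -/
theorem MCell.ch_sWord_eq_zero (Z : MCell) (f : Fin 4) (hf : (Z f).2 = (0, 0)) (s : Fin 16) : Z.ch (sWord s) = 0 := by
  have h0 : bphi (Z f) (sWord s f) = 0 := by
    have h1 : (Z f).2.1 = 0 := by rw [hf]
    have h2 : (Z f).2.2 = 0 := by rw [hf]
    by_cases hb : bitOf s f = 0 <;> simp [sWord, hb, bphi, phiVec, Zsqrtd.ext_iff, h1, h2]
  simp only [MCell.ch, chTensor]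
  fin_cases f <;> simp_all

/-! ## §3 Aggregation over a weighted configuration: the pattern weights `x_κ` and the rows -/

/-- **the AGGREGATED PATTERN WEIGHTS** `x_κ := Σ_{Z ∈ E₋ FC, κ(Z) = κ} m_Z C_Z − Σ_{P ∈ E₊ FC, κ(P) = κ} m_P C_P`
(`Pad4FCCore`: «x_κ := Σ_{Z FC, κ(Z) = κ} ε_Z m_Z C_Z»; orientation `N − P` as `MConfig.wch` — `Pad4FCCore`'s `Σ_P − Σ_N` is the
overall sign flip, immaterial for its homogeneous linear statements). -/
def MConfig.xPat (C : MConfig) (mN mP : MCell → ℤ) (κ : Fin 16) : ℤ :=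
  ∑ Z ∈ C.lower.filter (fun Z => FCc Z ∧ Z.pat = κ), mN Z * Z.cprod
    - ∑ P ∈ C.upper.filter (fun P => FCc P ∧ P.pat = κ), mP P * P.cprod

/-- one level: `Σ_{Z ∈ S} m_Z ch(Z)(w_s) = Σ_κ (Σ_{Z ∈ S FC, κ(Z)=κ} m_Z C_Z) · i^{⟨κ,s⟩}` when the FC classes of `S` lie in the window. -/
theorem sum_ch_sWord (S : Finset MCell) (m : MCell → ℤ) (hS : ∀ Z ∈ S, FCc Z → WinCell Z) (s : Fin 16) :
    ∑ Z ∈ S, (m Z : GaussianInt) * Z.ch (sWord s) =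
      ∑ κ : Fin 16, ((∑ Z ∈ S.filter (fun Z => FCc Z ∧ Z.pat = κ), m Z * Z.cprod : ℤ) : GaussianInt) * unitI ^ expKS κ s := by
  -- drop the non-FC classes
  have h1 : ∑ Z ∈ S, (m Z : GaussianInt) * Z.ch (sWord s) = ∑ Z ∈ S.filter FCc, (m Z : GaussianInt) * Z.ch (sWord s) := by
    rw [Finset.sum_filter]
    refine Finset.sum_congr rfl fun Z _ => ?_
    by_cases hZ : FCc Z
    · simp [hZ]
    · simp only [hZ, if_false]
      obtain ⟨f, hf⟩ : ∃ f, (Z f).2 = (0, 0) := by simpa [FCc] using hZ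
      simp [Z.ch_sWord_eq_zero f hf s]
  rw [h1, ← Finset.sum_fiberwise (S.filter FCc) MCell.pat]
  refine Finset.sum_congr rfl fun κ _ => ?_
  rw [Finset.filter_filter, Int.cast_sum, Finset.sum_mul]
  refine Finset.sum_congr rfl fun Z hZ => ?_
  obtain ⟨hZS, hFC, hpat⟩ := Finset.mem_filter.1 hZ
  rw [Z.ch_sWord (hS Z hZS hFC) s, hpat]
  push_cast
  ring

/-- **THE ROW IDENTITY**: `wch(w_s) = Σ_κ x_κ · i^{⟨κ,s⟩}` for every weighted configuration whose fully charged classes lie in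
the two-phase window. -/
theorem MConfig.wch_sWord (C : MConfig) (mN mP : MCell → ℤ) (hN : ∀ Z ∈ C.lower, FCc Z → WinCell Z)
    (hP : ∀ P ∈ C.upper, FCc P → WinCell P) (s : Fin 16) :
    C.wch mN mP (sWord s) = ∑ κ : Fin 16, (C.xPat mN mP κ : GaussianInt) * unitI ^ expKS κ s := by
  simp only [MConfig.wch, Pi.sub_apply, Finset.sum_apply, Pi.smul_apply]
  simp only [zsmul_eq_mul]
  rw [sum_ch_sWord C.lower mN hN s, sum_ch_sWord C.upper mP hP s, ← Finset.sum_sub_distrib]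
  refine Finset.sum_congr rfl fun κ _ => ?_
  rw [MConfig.xPat]
  push_cast
  ring

/-- the real part, as an additive map (bookkeeping for `re` of a sum). -/
def reHom : GaussianInt →+ ℤ where
  toFun := Zsqrtd.re
  map_zero' := rfl
  map_add' := Zsqrtd.re_add

/-- the imaginary part, as an additive map. -/
def imHom : GaussianInt →+ ℤ where
  toFun := Zsqrtd.im
  map_zero' := rfl
  map_add' := Zsqrtd.im_add

/-- **(A1) ⇒ THE MIXED ROWS VANISH** (both parts): for a mixed sign vector `s ∉ {0, 15}`, `Σ_κ x_κ Re i^{⟨κ,s⟩} = 0` and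
`Σ_κ x_κ Im i^{⟨κ,s⟩} = 0` — the class screen kills the e-mixed word `w_s`. -/
theorem MConfig.rows_of_classScreen (C : MConfig) (mN mP : MCell → ℤ) (hN : ∀ Z ∈ C.lower, FCc Z → WinCell Z)
    (hP : ∀ P ∈ C.upper, FCc P → WinCell P) (hA : ClassScreen (C.wch mN mP)) (s : Fin 16) (hs : s ≠ 0 ∧ s ≠ 15) :
    ∑ κ : Fin 16, C.xPat mN mP κ * (unitI ^ expKS κ s).re = 0 ∧ ∑ κ : Fin 16, C.xPat mN mP κ * (unitI ^ expKS κ s).im = 0 := by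
  obtain ⟨hnf, -, -, hne⟩ := sWord_spec
  have h0 : C.wch mN mP (sWord s) = 0 := hA.1 (sWord s) (hnf s) (hne s hs.1 hs.2).1 (hne s hs.1 hs.2).2
  rw [C.wch_sWord mN mP hN hP s] at h0
  have hre := congrArg reHom h0
  have him := congrArg imHom h0
  rw [map_sum, map_zero] at hre him
  constructor
  · rw [← hre]
    exact Finset.sum_congr rfl fun κ _ => by simp [reHom, Zsqrtd.re_mul, Zsqrtd.re_intCast, Zsqrtd.im_intCast]
  · rw [← him]
    exact Finset.sum_congr rfl fun κ _ => by simp [imHom, Zsqrtd.im_mul, Zsqrtd.re_intCast, Zsqrtd.im_intCast]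

/-! ## §4 The seam: `Pad4FCCore.MixedRowsVanish` from (A1), and FC-CORE's conclusions for weighted 𝔅(μ₄) configurations -/

/-- **KERNEL FC-CORE'S HYPOTHESIS FROM (A1)**: for every configuration whose fully charged classes lie in the two-phase window and
every integer multiplicity vector, the class screen on the weighted class tensor implies `Pad4FCCore.MixedRowsVanish` for the
aggregated pattern weights `x_κ` (cast to `ℚ`). -/
theorem MConfig.mixedRowsVanish_of_classScreen (C : MConfig) (mN mP : MCell → ℤ) (hN : ∀ Z ∈ C.lower, FCc Z → WinCell Z)
    (hP : ∀ P ∈ C.upper, FCc P → WinCell P) (hA : ClassScreen (C.wch mN mP)) :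
    Pad4FCCore.MixedRowsVanish fun κ => (C.xPat mN mP κ : ℚ) :=
  ⟨
    (by have h := dot16q _ _ ![1, 0, 0, 1, 0, 1, -1, 0, 0, 1, -1, 0, -1, 0, 0, -1] (by decide) (C.rows_of_classScreen mN mP hN hP hA 1 (by decide)).1; simp only [Matrix.cons_val] at h; push_cast at h ⊢; linarith),
    (by have h := dot16q _ _ ![0, -1, 1, 0, 1, 0, 0, 1, 1, 0, 0, 1, 0, 1, -1, 0] (by decide) (C.rows_of_classScreen mN mP hN hP hA 1 (by decide)).2; simp only [Matrix.cons_val] at h; push_cast at h ⊢; linarith),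
    (by have h := dot16q _ _ ![1, 0, 0, 1, 0, -1, 1, 0, 0, -1, 1, 0, -1, 0, 0, -1] (by decide) (C.rows_of_classScreen mN mP hN hP hA 2 (by decide)).1; simp only [Matrix.cons_val] at h; push_cast at h ⊢; linarith),
    (by have h := dot16q _ _ ![0, 1, -1, 0, 1, 0, 0, 1, 1, 0, 0, 1, 0, -1, 1, 0] (by decide) (C.rows_of_classScreen mN mP hN hP hA 2 (by decide)).2; simp only [Matrix.cons_val] at h; push_cast at h ⊢; linarith),
    (by have h := dot16q _ _ ![1, 0, 0, -1, 0, 1, 1, 0, 0, 1, 1, 0, -1, 0, 0, 1] (by decide) (C.rows_of_classScreen mN mP hN hP hA 3 (by decide)).1; simp only [Matrix.cons_val] at h; push_cast at h ⊢; linarith),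
    (by have h := dot16q _ _ ![0, -1, -1, 0, 1, 0, 0, -1, 1, 0, 0, -1, 0, 1, 1, 0] (by decide) (C.rows_of_classScreen mN mP hN hP hA 3 (by decide)).2; simp only [Matrix.cons_val] at h; push_cast at h ⊢; linarith),
    (by have h := dot16q _ _ ![1, 0, 0, -1, 0, 1, 1, 0, 0, -1, -1, 0, 1, 0, 0, -1] (by decide) (C.rows_of_classScreen mN mP hN hP hA 4 (by decide)).1; simp only [Matrix.cons_val] at h; push_cast at h ⊢; linarith),
    (by have h := dot16q _ _ ![0, 1, 1, 0, -1, 0, 0, 1, 1, 0, 0, -1, 0, 1, 1, 0] (by decide) (C.rows_of_classScreen mN mP hN hP hA 4 (by decide)).2; simp only [Matrix.cons_val] at h; push_cast at h ⊢; linarith),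
    (by have h := dot16q _ _ ![1, 0, 0, 1, 0, -1, 1, 0, 0, 1, -1, 0, 1, 0, 0, 1] (by decide) (C.rows_of_classScreen mN mP hN hP hA 5 (by decide)).1; simp only [Matrix.cons_val] at h; push_cast at h ⊢; linarith),
    (by have h := dot16q _ _ ![0, -1, 1, 0, -1, 0, 0, -1, 1, 0, 0, 1, 0, -1, 1, 0] (by decide) (C.rows_of_classScreen mN mP hN hP hA 5 (by decide)).2; simp only [Matrix.cons_val] at h; push_cast at h ⊢; linarith),
    (by have h := dot16q _ _ ![1, 0, 0, 1, 0, 1, -1, 0, 0, -1, 1, 0, 1, 0, 0, 1] (by decide) (C.rows_of_classScreen mN mP hN hP hA 6 (by decide)).1; simp only [Matrix.cons_val] at h; push_cast at h ⊢; linarith),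
    (by have h := dot16q _ _ ![0, 1, -1, 0, -1, 0, 0, -1, 1, 0, 0, 1, 0, 1, -1, 0] (by decide) (C.rows_of_classScreen mN mP hN hP hA 6 (by decide)).2; simp only [Matrix.cons_val] at h; push_cast at h ⊢; linarith),
    (by have h := dot16q _ _ ![1, 0, 0, -1, 0, -1, -1, 0, 0, 1, 1, 0, 1, 0, 0, -1] (by decide) (C.rows_of_classScreen mN mP hN hP hA 7 (by decide)).1; simp only [Matrix.cons_val] at h; push_cast at h ⊢; linarith),
    (by have h := dot16q _ _ ![0, -1, -1, 0, -1, 0, 0, 1, 1, 0, 0, -1, 0, -1, -1, 0] (by decide) (C.rows_of_classScreen mN mP hN hP hA 7 (by decide)).2; simp only [Matrix.cons_val] at h; push_cast at h ⊢; linarith),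
    (by have h := dot16q _ _ ![1, 0, 0, -1, 0, -1, -1, 0, 0, 1, 1, 0, 1, 0, 0, -1] (by decide) (C.rows_of_classScreen mN mP hN hP hA 8 (by decide)).1; simp only [Matrix.cons_val] at h; push_cast at h ⊢; linarith),
    (by have h := dot16q _ _ ![0, 1, 1, 0, 1, 0, 0, -1, -1, 0, 0, 1, 0, 1, 1, 0] (by decide) (C.rows_of_classScreen mN mP hN hP hA 8 (by decide)).2; simp only [Matrix.cons_val] at h; push_cast at h ⊢; linarith),
    (by have h := dot16q _ _ ![1, 0, 0, 1, 0, 1, -1, 0, 0, -1, 1, 0, 1, 0, 0, 1] (by decide) (C.rows_of_classScreen mN mP hN hP hA 9 (by decide)).1; simp only [Matrix.cons_val] at h; push_cast at h ⊢; linarith),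
    (by have h := dot16q _ _ ![0, -1, 1, 0, 1, 0, 0, 1, -1, 0, 0, -1, 0, -1, 1, 0] (by decide) (C.rows_of_classScreen mN mP hN hP hA 9 (by decide)).2; simp only [Matrix.cons_val] at h; push_cast at h ⊢; linarith),
    (by have h := dot16q _ _ ![1, 0, 0, 1, 0, -1, 1, 0, 0, 1, -1, 0, 1, 0, 0, 1] (by decide) (C.rows_of_classScreen mN mP hN hP hA 10 (by decide)).1; simp only [Matrix.cons_val] at h; push_cast at h ⊢; linarith),
    (by have h := dot16q _ _ ![0, 1, -1, 0, 1, 0, 0, 1, -1, 0, 0, -1, 0, 1, -1, 0] (by decide) (C.rows_of_classScreen mN mP hN hP hA 10 (by decide)).2; simp only [Matrix.cons_val] at h; push_cast at h ⊢; linarith),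
    (by have h := dot16q _ _ ![1, 0, 0, -1, 0, 1, 1, 0, 0, -1, -1, 0, 1, 0, 0, -1] (by decide) (C.rows_of_classScreen mN mP hN hP hA 11 (by decide)).1; simp only [Matrix.cons_val] at h; push_cast at h ⊢; linarith),
    (by have h := dot16q _ _ ![0, -1, -1, 0, 1, 0, 0, -1, -1, 0, 0, 1, 0, -1, -1, 0] (by decide) (C.rows_of_classScreen mN mP hN hP hA 11 (by decide)).2; simp only [Matrix.cons_val] at h; push_cast at h ⊢; linarith),
    (by have h := dot16q _ _ ![1, 0, 0, -1, 0, 1, 1, 0, 0, 1, 1, 0, -1, 0, 0, 1] (by decide) (C.rows_of_classScreen mN mP hN hP hA 12 (by decide)).1; simp only [Matrix.cons_val] at h; push_cast at h ⊢; linarith),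
    (by have h := dot16q _ _ ![0, 1, 1, 0, -1, 0, 0, 1, -1, 0, 0, 1, 0, -1, -1, 0] (by decide) (C.rows_of_classScreen mN mP hN hP hA 12 (by decide)).2; simp only [Matrix.cons_val] at h; push_cast at h ⊢; linarith),
    (by have h := dot16q _ _ ![1, 0, 0, 1, 0, -1, 1, 0, 0, -1, 1, 0, -1, 0, 0, -1] (by decide) (C.rows_of_classScreen mN mP hN hP hA 13 (by decide)).1; simp only [Matrix.cons_val] at h; push_cast at h ⊢; linarith),
    (by have h := dot16q _ _ ![0, -1, 1, 0, -1, 0, 0, -1, -1, 0, 0, -1, 0, 1, -1, 0] (by decide) (C.rows_of_classScreen mN mP hN hP hA 13 (by decide)).2; simp only [Matrix.cons_val] at h; push_cast at h ⊢; linarith),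
    (by have h := dot16q _ _ ![1, 0, 0, 1, 0, 1, -1, 0, 0, 1, -1, 0, -1, 0, 0, -1] (by decide) (C.rows_of_classScreen mN mP hN hP hA 14 (by decide)).1; simp only [Matrix.cons_val] at h; push_cast at h ⊢; linarith),
    (by have h := dot16q _ _ ![0, 1, -1, 0, -1, 0, 0, -1, -1, 0, 0, -1, 0, -1, 1, 0] (by decide) (C.rows_of_classScreen mN mP hN hP hA 14 (by decide)).2; simp only [Matrix.cons_val] at h; push_cast at h ⊢; linarith)⟩

/-- **`μ` of FC-CORE is the `ēēēē`-coefficient of the weighted class tensor** (`Pad4FCCore`: `μ := coeff(eeee)` in ITS `e`-slot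
convention = this frame's `ēēēē`): `muRe x = Re wch(ēēēē)`, `muIm x = Im wch(ēēēē)`. -/
theorem MConfig.mu_fcCore (C : MConfig) (mN mP : MCell → ℤ) (hN : ∀ Z ∈ C.lower, FCc Z → WinCell Z)
    (hP : ∀ P ∈ C.upper, FCc P → WinCell P) :
    Pad4FCCore.muRe (fun κ => (C.xPat mN mP κ : ℚ)) = ((C.wch mN mP ebarWord).re : ℚ) ∧
      Pad4FCCore.muIm (fun κ => (C.xPat mN mP κ : ℚ)) = ((C.wch mN mP ebarWord).im : ℚ) := by
  obtain ⟨-, h0, -, -⟩ := sWord_spec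
  have hw := C.wch_sWord mN mP hN hP 0
  rw [h0] at hw
  have hre := congrArg reHom hw
  have him := congrArg imHom hw
  rw [map_sum] at hre him
  have hre' : (C.wch mN mP ebarWord).re = ∑ κ : Fin 16, C.xPat mN mP κ * (unitI ^ expKS κ 0).re :=
    hre.trans (Finset.sum_congr rfl fun κ _ => by simp [reHom, Zsqrtd.re_mul, Zsqrtd.re_intCast, Zsqrtd.im_intCast])
  have him' : (C.wch mN mP ebarWord).im = ∑ κ : Fin 16, C.xPat mN mP κ * (unitI ^ expKS κ 0).im :=
    him.trans (Finset.sum_congr rfl fun κ _ => by simp [imHom, Zsqrtd.im_mul, Zsqrtd.re_intCast, Zsqrtd.im_intCast])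
  have vre : (fun κ : Fin 16 => (unitI ^ expKS κ 0).re) = ![1, 0, 0, -1, 0, -1, -1, 0, 0, -1, -1, 0, -1, 0, 0, 1] := by decide
  have vim : (fun κ : Fin 16 => (unitI ^ expKS κ 0).im) = ![0, 1, 1, 0, 1, 0, 0, -1, 1, 0, 0, -1, 0, -1, -1, 0] := by decide
  rw [hre', him', show (fun κ : Fin 16 => C.xPat mN mP κ * (unitI ^ expKS κ 0).re) =
      fun κ => C.xPat mN mP κ * (![1, 0, 0, -1, 0, -1, -1, 0, 0, -1, -1, 0, -1, 0, 0, 1] : Fin 16 → ℤ) κ from by rw [← vre],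
    show (fun κ : Fin 16 => C.xPat mN mP κ * (unitI ^ expKS κ 0).im) =
      fun κ => C.xPat mN mP κ * (![0, 1, 1, 0, 1, 0, 0, -1, 1, 0, 0, -1, 0, -1, -1, 0] : Fin 16 → ℤ) κ from by rw [← vim], sum16, sum16]
  simp only [Matrix.cons_val, Pad4FCCore.muRe, Pad4FCCore.muIm]
  push_cast
  constructor <;> ring

/-- conjugation on one cell: the `ēēēē`-coefficient is the conjugate of the `eeee`-coefficient (`β̄⁴` vs `β⁴` products). -/
theorem MCell.ch_ebarWord_eq_star (Z : MCell) : Z.ch ebarWord = star (Z.ch eWord) := by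
  simp only [MCell.ch, chTensor, bphi, phiVec, eWord, ebarWord, Matrix.cons_val, star_mul', Zsqrtd.star_mk]

/-- **`wch(ēēēē) = conj wch(eeee)`** (s4-ref g85 (F) P1): FC-CORE's μ (this frame's `ēēēē`-coefficient) is the complex conjugate of
FILE A's μ-word orientation (`eeee`, `Pad4TowerPsiSubA1.Design.ch_eWord`); in particular the two are non-zero together. -/
theorem MConfig.wch_ebarWord_eq_star (C : MConfig) (mN mP : MCell → ℤ) :
    C.wch mN mP ebarWord = star (C.wch mN mP eWord) := by
  simp only [MConfig.wch, Pi.sub_apply, Finset.sum_apply, Pi.smul_apply, star_sub, star_sum, star_zsmul,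
    MCell.ch_ebarWord_eq_star]

/-- `wch(ēēēē) ≠ 0 ↔ wch(eeee) ≠ 0`. -/
theorem MConfig.wch_ebarWord_ne_zero_iff (C : MConfig) (mN mP : MCell → ℤ) :
    C.wch mN mP ebarWord ≠ 0 ↔ C.wch mN mP eWord ≠ 0 := by
  rw [C.wch_ebarWord_eq_star mN mP, ne_eq, star_eq_zero]

/-- **FC-CORE FOR WEIGHTED 𝔅(μ₄) CONFIGURATIONS** (the seam composed with `Pad4FCCore.eight_patterns_of_mu_ne`): if the fully charged
classes lie in the two-phase window, the weighted class tensor passes the class screen (A1) and its `ēēēē`-coefficient (FC-CORE's μ)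
is non-zero, then the aggregated pattern weights are non-zero at ALL EIGHT even-weight patterns or at ALL EIGHT odd-weight patterns —
in particular the support holds fully charged classes in at least eight phase patterns. -/
theorem MConfig.eight_patterns_of_classScreen (C : MConfig) (mN mP : MCell → ℤ) (hN : ∀ Z ∈ C.lower, FCc Z → WinCell Z)
    (hP : ∀ P ∈ C.upper, FCc P → WinCell P) (hA : ClassScreen (C.wch mN mP)) (hμ : C.wch mN mP ebarWord ≠ 0) :
    let x : Fin 16 → ℚ := fun κ => (C.xPat mN mP κ : ℚ)
    (x 0 ≠ 0 ∧ x 3 ≠ 0 ∧ x 5 ≠ 0 ∧ x 6 ≠ 0 ∧ x 9 ≠ 0 ∧ x 10 ≠ 0 ∧ x 12 ≠ 0 ∧ x 15 ≠ 0) ∨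
      (x 1 ≠ 0 ∧ x 2 ≠ 0 ∧ x 4 ≠ 0 ∧ x 7 ≠ 0 ∧ x 8 ≠ 0 ∧ x 11 ≠ 0 ∧ x 13 ≠ 0 ∧ x 14 ≠ 0) := by
  intro x
  apply Pad4FCCore.eight_patterns_of_mu_ne x (C.mixedRowsVanish_of_classScreen mN mP hN hP hA)
  obtain ⟨hre, him⟩ := C.mu_fcCore mN mP hN hP
  by_contra hc
  push Not at hc
  apply hμ
  refine Zsqrtd.ext ?_ ?_
  · have := hc.1; rw [hre] at this; exact_mod_cast this
  · have := hc.2; rw [him] at this; exact_mod_cast this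

/-- the same with the hypothesis on the `eeee`-coefficient (FILE A's μ-word orientation). -/
theorem MConfig.eight_patterns_of_classScreen' (C : MConfig) (mN mP : MCell → ℤ) (hN : ∀ Z ∈ C.lower, FCc Z → WinCell Z)
    (hP : ∀ P ∈ C.upper, FCc P → WinCell P) (hA : ClassScreen (C.wch mN mP)) (hμ : C.wch mN mP eWord ≠ 0) :
    let x : Fin 16 → ℚ := fun κ => (C.xPat mN mP κ : ℚ)
    (x 0 ≠ 0 ∧ x 3 ≠ 0 ∧ x 5 ≠ 0 ∧ x 6 ≠ 0 ∧ x 9 ≠ 0 ∧ x 10 ≠ 0 ∧ x 12 ≠ 0 ∧ x 15 ≠ 0) ∨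
      (x 1 ≠ 0 ∧ x 2 ≠ 0 ∧ x 4 ≠ 0 ∧ x 7 ≠ 0 ∧ x 8 ≠ 0 ∧ x 11 ≠ 0 ∧ x 13 ≠ 0 ∧ x 14 ≠ 0) :=
  C.eight_patterns_of_classScreen mN mP hN hP hA ((C.wch_ebarWord_ne_zero_iff mN mP).2 hμ)

/-- a pattern weight is non-zero only if a fully charged class of that pattern is PRESENT. -/
theorem MConfig.exists_of_xPat_ne (C : MConfig) (mN mP : MCell → ℤ) (κ : Fin 16) (h : (C.xPat mN mP κ : ℚ) ≠ 0) :
    ∃ Z, (Z ∈ C.lower ∨ Z ∈ C.upper) ∧ FCc Z ∧ Z.pat = κ := by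
  by_contra hc
  push Not at hc
  apply h
  have hl : ∑ Z ∈ C.lower.filter (fun Z => FCc Z ∧ Z.pat = κ), mN Z * Z.cprod = 0 :=
    Finset.sum_eq_zero fun Z hZ => by
      obtain ⟨hZl, hfc, hp⟩ := Finset.mem_filter.1 hZ
      exact absurd hp (hc Z (Or.inl hZl) hfc)
  have hu : ∑ P ∈ C.upper.filter (fun P => FCc P ∧ P.pat = κ), mP P * P.cprod = 0 :=
    Finset.sum_eq_zero fun P hPm => by
      obtain ⟨hPu, hfc, hp⟩ := Finset.mem_filter.1 hPm
      exact absurd hp (hc P (Or.inr hPu) hfc)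
  simp [MConfig.xPat, hl, hu]

end Summit.Ventures.HSemireg.Pad4Tower
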